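import Summits.BirchSwinnertonDyer.Rank1Residual.X11b.CoinvariantsDescent
import Literature.NumberTheory.EllipticCurves.IwasawaSelmerDualProofs
import Literature.NumberTheory.EllipticCurves.IwasawaDualModule
import HarnessLib

/-!
# Route UniversalToricDescent — the local toolkit at a finitely decomposed place `v` for the
# `Σ → ∅` passage over `K_∞`: open stabilisers of the `D_v`-action on `H¹(H ∩ D_v, E[p^∞])`,
# the exact index `κ(D_v) = p^c ℤ_p`, and the decomposition `Γ_K = D_v · γ^ℕ · H`

Lead prover bsd-wall-utd-p1 g8 (`--supports stmt-BirchSwinnertonDyer-20399`; memo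
ALG-HALF-21845-STATUS-utdp1g7 §3, the ONE algebraic input left in child 21845: the local image
`im(Sel_𝔭^{Σ∪{v}}(K_∞) → ⊕_{w∣v} H¹(K_{∞,w}, E[p^∞]))`, Greenberg–Vatsal Cor. (2.3)). For a
`ℤ_p`-extension `κ` of a number field `K` (`H = ker κ`, topological generator `γ`, `κ γ = 1`), a
discrete `Γ_K`-module `M` with open stabilisers, and a finite place `v` with decomposition group
`D_v` (`GreenbergSelmer.decomp v`; `kerD κ v = H ∩ D_v ≤ D_v`, `X11b.CoinvariantsLocal`):

* §1 `exists_pow_and_forall_dvd_of_not_le` — if `v` is finitely decomposed in `K_∞` (`D_v ⊄ H`) then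
  `κ(D_v) = p^c ℤ_p` EXACTLY for some `c`: some `d₀ ∈ D_v` has `κ d₀ = p^c`, every `p^c z` is a value,
  and `p^c` divides every value (`ProcyclicDescent.imageIdeal_eq_bot_or` for `κ|_{D_v}`); `p^c` is the
  number of places of `K_∞` above `v`.
* §2 `exists_decomp_mul_pow_mul_mem_ker` — `Γ_K = D_v · γ^ℕ · H`: every `σ` is `d · γ^n · h`
  (`n ≡ κ σ (mod p^c)`); `pow_eq_pow_of_decomp` — with the exact index, `d γ^i h = d′ γ^j h′` and
  `i, j < p^c` force `i = j` (the `p^c` cosets `D_v γ^i H`, `i < p^c`, are distinct).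
* §3 (A1)_v `exists_openNormalSubgroup_conjH1_kerD_eq` — every class of `H¹(H ∩ D_v, M)` is fixed by
  `conj_d` for `d` in an open normal subgroup of `D_v` (continuity of the `D_v`-action; the tree's (A1)
  `exists_openNormalSubgroup_conjH1_eq` with `Γ_K ↦ D_v`); (A2)_v
  `exists_forall_dvd_imp_conjH1_kerD_eq` — hence by every `d` with `p^t ∣ κ d` for some `t`
  (`d = d₃^{[D_v:U]} · k`, `k ∈ H ∩ D_v` acting trivially); (P)_v `exists_pow_smul_kerD_eq_zero` —
  every class is killed by a power of `p` when `M` is `p`-primary.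

THEOREMS ONLY (no definition, no named fact, no `sorry`); nothing about Selmer groups is asserted here.
BSD is not advanced by this file.
References: [GreenbergVatsal2000] §2 Cor. (2.3), Prop. (2.4) (pp. 24–25); [GreenbergLNM1716] §1
(after Conj. 1.3, p. 60) and §3 Lemma 3.3 (p. 87); [Washington1997] §13.1; [SerreGaloisCohomology1997]
I §2.5.
-/

set_option autoImplicit false
-- `…BirchSwinnertonDyer.BirchSwinnertonDyer.Theorems…` is the problem's mandated namespace (D-0017).
set_option linter.dupNamespace false

noncomputable section

open scoped Classical

namespace Summit.BirchSwinnertonDyer.BirchSwinnertonDyer.Theorems.UniversalToricDescentSigmaLocalStabilizer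

open Field NumberField IsDedekindDomain
open Literature.NumberTheory.GaloisRepresentations Literature.NumberTheory.EllipticCurves
  Literature.NumberTheory.EllipticCurves.GreenbergSelmer
  Summit.BirchSwinnertonDyer.Rank1Residual.X11b Summit.BirchSwinnertonDyer.Rank1Residual.X11b.Coinv
open Summit.BirchSwinnertonDyer.Rank1Residual.X11b.ProcyclicDescent (kerK)

variable {K : Type} [Field K] [NumberField K] {p : ℕ} [Fact p.Prime] (κ : ZpExtension K p)

/-! ### §1 The exact index: `κ(D_v) = p^c ℤ_p` at a finitely decomposed place -/

/-- **`κ(D_v) = p^c ℤ_p` exactly** at a place `v` finitely decomposed in `K_∞` (`D_v ⊄ ker κ`): there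
are `c` and `d₀ ∈ D_v` with `κ d₀ = p^c`, every `p^c z` (`z ∈ ℤ_p`) is `κ d` for some `d ∈ D_v`, and
`p^c ∣ κ d` for every `d ∈ D_v` (the image of the compact `D_v` is a non-zero ideal of `ℤ_p`). The
`p^c` cosets of `D_v · ker κ = κ⁻¹(p^c ℤ_p)` are the places of `K_∞` above `v`.
[cite: Washington1997, §13.1] [cite: GreenbergLNM1716, §1 ("finitely decomposed")] -/
theorem exists_pow_and_forall_dvd_of_not_le (v : HeightOneSpectrum (𝓞 K))
    (hv : ¬ (decomp v ≤ κ.kerSubgroup)) :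
    ∃ c : ℕ, (∃ d₀ : decomp (K := K) v, (κ (d₀ : absoluteGaloisGroup K)).toAdd = (p : ℤ_[p]) ^ c) ∧
      (∀ z : ℤ_[p], ∃ d : decomp (K := K) v,
        (κ (d : absoluteGaloisGroup K)).toAdd = (p : ℤ_[p]) ^ c * z) ∧
      ∀ d : decomp (K := K) v, (p : ℤ_[p]) ^ c ∣ (κ (d : absoluteGaloisGroup K)).toAdd := by
  haveI : CompactSpace (absoluteGaloisGroup K) := absoluteGaloisGroup_compactSpace K
  haveI : CompactSpace (decomp (K := K) v) :=
    isCompact_iff_compactSpace.mp (isClosed_decomp v).isCompact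
  rcases ProcyclicDescent.imageIdeal_eq_bot_or (kappaD κ v) with h0 | ⟨c, d₀, hd₀, hdiv⟩
  · refine (hv fun g hg ↦ ?_).elim
    rw [ZpExtension.mem_kerSubgroup]
    exact h0 ⟨g, hg⟩
  · refine ⟨c, ⟨d₀, hd₀⟩, fun z ↦ ?_, fun d ↦ hdiv d⟩
    have hmem : (p : ℤ_[p]) ^ c * z ∈ ProcyclicDescent.imageIdeal (kappaD κ v) :=
      Ideal.mul_mem_right z _ (by rw [← hd₀]; exact ProcyclicDescent.toAdd_mem_imageIdeal _ d₀)
    obtain ⟨d, hd⟩ := (ProcyclicDescent.mem_imageIdeal_iff (kappaD κ v) _).mp hmem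
    exact ⟨d, hd⟩

/-! ### §2 `Γ_K = D_v · γ^ℕ · ker κ` -/

/-- **Every `σ ∈ Γ_K` is `d · γ^n · h`** with `d ∈ D_v`, `n ∈ ℕ`, `h ∈ ker κ`, as soon as
`κ(D_v) ⊇ p^c ℤ_p` (`n` the residue of `κ σ` modulo `p^c`, `PadicInt.appr`; `γ` a topological
generator, `κ γ = 1`). [cite: Washington1997, §13.1] -/
theorem exists_decomp_mul_pow_mul_mem_ker {γ : absoluteGaloisGroup K} (hγ : κ.IsTopGenerator γ)
    (v : HeightOneSpectrum (𝓞 K)) {c : ℕ}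
    (hc : ∀ z : ℤ_[p], ∃ d : decomp (K := K) v,
      (κ (d : absoluteGaloisGroup K)).toAdd = (p : ℤ_[p]) ^ c * z)
    (σ : absoluteGaloisGroup K) :
    ∃ (d : decomp (K := K) v) (n : ℕ) (h : absoluteGaloisGroup K), h ∈ κ.kerSubgroup ∧
      σ = d * γ ^ n * h := by
  set x : ℤ_[p] := (κ σ).toAdd with hx
  obtain ⟨z, hz⟩ := Ideal.mem_span_singleton.mp (PadicInt.appr_spec c x)
  obtain ⟨d, hd⟩ := hc z
  refine ⟨d, x.appr c, ((d : absoluteGaloisGroup K) * γ ^ x.appr c)⁻¹ * σ, ?_, ?_⟩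
  · rw [ZpExtension.mem_kerSubgroup, map_mul, map_inv, map_mul, map_pow,
      show κ γ = Multiplicative.ofAdd 1 from hγ, ← ofAdd_nsmul]
    apply Multiplicative.toAdd.injective
    rw [toAdd_mul, toAdd_inv, toAdd_mul, toAdd_ofAdd, toAdd_one, hd, nsmul_eq_mul, mul_one, ← hx]
    linear_combination hz
  · rw [mul_inv_cancel_left]

/-- **The cosets `D_v γ^i ker κ`, `i < p^c`, are distinct** when `p^c ∣ κ d` for every `d ∈ D_v`:
`d γ^i h = d′ γ^j h′` with `i, j < p^c` forces `i = j` (apply `κ` and reduce modulo `p^c`).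
[cite: Washington1997, §13.1] -/
theorem eq_of_decomp_mul_pow_mul_eq {γ : absoluteGaloisGroup K} (hγ : κ.IsTopGenerator γ)
    (v : HeightOneSpectrum (𝓞 K)) {c : ℕ}
    (hle : ∀ d : decomp (K := K) v, (p : ℤ_[p]) ^ c ∣ (κ (d : absoluteGaloisGroup K)).toAdd)
    {d d' : decomp (K := K) v} {i j : ℕ} (hi : i < p ^ c) (hj : j < p ^ c)
    {h h' : absoluteGaloisGroup K} (hh : h ∈ κ.kerSubgroup) (hh' : h' ∈ κ.kerSubgroup)
    (e : (d : absoluteGaloisGroup K) * γ ^ i * h = (d' : absoluteGaloisGroup K) * γ ^ j * h') :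
    i = j := by
  rw [ZpExtension.mem_kerSubgroup] at hh hh'
  have hκ := congrArg (fun g ↦ (κ g).toAdd) e
  simp only [map_mul, map_pow, toAdd_mul, show κ γ = Multiplicative.ofAdd 1 from hγ, ← ofAdd_nsmul,
    toAdd_ofAdd, hh, hh', nsmul_eq_mul, mul_one] at hκ
  -- `κ d + i = κ d' + j` with `p^c ∣ κ d, κ d'`
  obtain ⟨a, ha⟩ := hle d
  obtain ⟨b, hb⟩ := hle d'
  rw [ha, hb] at hκ
  have hij : ((i : ℤ_[p]) : ℤ_[p]) - (j : ℤ_[p]) = (p : ℤ_[p]) ^ c * (b - a) := by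
    rw [mul_sub]; linear_combination hκ
  have hmod : (PadicInt.toZModPow c (i : ℤ_[p])) = PadicInt.toZModPow c (j : ℤ_[p]) := by
    rw [← sub_eq_zero, ← map_sub, ← RingHom.mem_ker, PadicInt.ker_toZModPow,
      Ideal.mem_span_singleton]
    exact ⟨b - a, hij⟩
  rw [map_natCast, map_natCast] at hmod
  have h1 := congrArg ZMod.val hmod
  rwa [ZMod.val_natCast_of_lt hi, ZMod.val_natCast_of_lt hj] at h1

/-! ### §3 Open stabilisers of the `D_v`-action on `H¹(H ∩ D_v, M)` -/

section Stabilizer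

variable {M : Type} [AddCommGroup M] [DistribMulAction (absoluteGaloisGroup K) M]
  [TopologicalSpace M] [DiscreteTopology M]

/-- `H ∩ D_v = ker(κ|_{D_v})` is closed in `D_v` (a kernel), hence compact. [folklore] -/
theorem isClosed_kerD (v : HeightOneSpectrum (𝓞 K)) :
    IsClosed ((kerD κ v : Subgroup (decomp (K := K) v)) : Set (decomp (K := K) v)) := by
  have e : ((kerD κ v : Subgroup (decomp (K := K) v)) : Set (decomp (K := K) v)) =
      (kappaD κ v) ⁻¹' {1} := by
    ext d
    simp only [SetLike.mem_coe, Set.mem_preimage, Set.mem_singleton_iff]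
    exact Iff.rfl
  rw [e]
  exact isClosed_singleton.preimage (kappaD κ v).continuous

/-- **(A1)_v.** Every class of `H¹(H ∩ D_v, M)` is fixed by `conj_d` for all `d` in some open normal
subgroup of `D_v`, when the points of `M` have open stabilisers: the cocycle takes finitely many
values (each with open stabiliser) and vanishes near `1`; an open normal subgroup of the profinite
`D_v` inside both open sets works by the cocycle-level criterion `IwasawaDual.conjH1_oneCocycleClass_eq`
(the tree's (A1) `exists_openNormalSubgroup_conjH1_eq` with `Γ_K ↦ D_v`, `ker κ ↦ H ∩ D_v`).
[cite: GreenbergLNM1716, §1 (after Conj. 1.3)] [cite: SerreGaloisCohomology1997, I §2.5] -/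
theorem exists_openNormalSubgroup_conjH1_kerD_eq
    (hstab : ∀ m : M,
      IsOpen (MulAction.stabilizer (absoluteGaloisGroup K) m : Set (absoluteGaloisGroup K)))
    (v : HeightOneSpectrum (𝓞 K)) (f : subgroupH1 (kerD κ v) M) :
    ∃ U : OpenNormalSubgroup (decomp (K := K) v), ∀ d ∈ U, conjH1 (kerD κ v) M d f = f := by
  haveI : CompactSpace (absoluteGaloisGroup K) := absoluteGaloisGroup_compactSpace K
  haveI : CompactSpace (decomp (K := K) v) :=
    isCompact_iff_compactSpace.mp (isClosed_decomp v).isCompact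
  haveI : CompactSpace (kerD κ v) := isCompact_iff_compactSpace.mp (isClosed_kerD κ v).isCompact
  obtain ⟨φ, rfl⟩ := oneCocycleClass_surjective _ f
  have hfin : (Set.range φ.1).Finite := (isCompact_range φ.1.continuous).finite_of_discrete
  -- the elements of `D_v` fixing all values of `φ`
  set Ufix : Set (decomp (K := K) v) := {d | ∀ m ∈ Set.range φ.1, d • m = m} with hUfix_def
  have hUfix : IsOpen Ufix := by
    have e : Ufix = ⋂ m ∈ Set.range φ.1,
        (Subtype.val ⁻¹' (MulAction.stabilizer (absoluteGaloisGroup K) m : Set (absoluteGaloisGroup K))) := by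
      ext d
      simp only [hUfix_def, Set.mem_setOf_eq, Set.mem_iInter, Set.mem_preimage, SetLike.mem_coe,
        MulAction.mem_stabilizer_iff]
      exact Iff.rfl
    rw [e]
    exact hfin.isOpen_biInter fun m _ ↦ (hstab m).preimage continuous_subtype_val
  -- the zero set of `φ`, open in `H ∩ D_v`, comes from an open `U0 ⊆ D_v`
  have hz : IsOpen {h : kerD κ v | φ.1 h = 0} :=
    (isOpen_discrete ({0} : Set M)).preimage φ.1.continuous
  obtain ⟨U0, hU0, hU0eq⟩ := isOpen_induced_iff.mp hz
  have h1fix : (1 : decomp (K := K) v) ∈ Ufix := fun m _ ↦ one_smul _ m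
  have h1U0 : (1 : decomp (K := K) v) ∈ U0 := by
    have : (1 : kerD κ v) ∈ Subtype.val ⁻¹' U0 := by
      rw [hU0eq]
      exact contOneCocycles.apply_one φ
    exact this
  obtain ⟨Nrm, hNrm⟩ := ProfiniteGrp.exist_openNormalSubgroup_sub_open_nhds_of_one
    (hUfix.inter hU0) ⟨h1fix, h1U0⟩
  refine ⟨Nrm, fun d hd ↦ IwasawaDual.conjH1_oneCocycleClass_eq φ (fun h ↦ ?_) (fun h n hn ↦ ?_)⟩
  · exact (hNrm hd).1 _ ⟨h, rfl⟩
  · have hnN : (n : decomp (K := K) v) ∈ Nrm := by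
      rw [hn]
      have h1 : (h : decomp (K := K) v)⁻¹ * d⁻¹ * (h : decomp (K := K) v)⁻¹⁻¹ ∈ Nrm.toSubgroup :=
        Subgroup.Normal.conj_mem inferInstance _ (Nrm.toSubgroup.inv_mem hd) _
      rw [inv_inv] at h1
      exact Nrm.toSubgroup.mul_mem h1 hd
    have hn0 : n ∈ Subtype.val ⁻¹' U0 := (hNrm hnN).2
    rw [hU0eq] at hn0
    exact hn0

/-- **(A2)_v.** With `κ(D_v) ⊇ p^c ℤ_p` (every `p^c z` a value on `D_v`): every class `f` of
`H¹(H ∩ D_v, M)` is fixed by `conj_d` for every `d ∈ D_v` with `p^t ∣ κ d`, for some `t` (`M` with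
open stabilisers). With `U` as in (A1)_v of index `m = p^a e`, `p ∤ e`, and `t = c + a`: if
`κ d = p^{c+a} z` then `d = d₃^m · k` with `κ d₃ = p^c z e⁻¹`, `d₃^m ∈ U` and `k ∈ H ∩ D_v` (which
acts trivially, `conjH1_of_mem_holds`). [cite: GreenbergLNM1716, §1 (after Conj. 1.3)]
[cite: Washington1997, §13.1] -/
theorem exists_forall_dvd_imp_conjH1_kerD_eq
    (hstab : ∀ m : M,
      IsOpen (MulAction.stabilizer (absoluteGaloisGroup K) m : Set (absoluteGaloisGroup K)))
    (v : HeightOneSpectrum (𝓞 K)) {c : ℕ}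
    (hc : ∀ z : ℤ_[p], ∃ d : decomp (K := K) v,
      (κ (d : absoluteGaloisGroup K)).toAdd = (p : ℤ_[p]) ^ c * z)
    (f : subgroupH1 (kerD κ v) M) :
    ∃ t : ℕ, ∀ d : decomp (K := K) v,
      (p : ℤ_[p]) ^ t ∣ (κ (d : absoluteGaloisGroup K)).toAdd → conjH1 (kerD κ v) M d f = f := by
  haveI : CompactSpace (absoluteGaloisGroup K) := absoluteGaloisGroup_compactSpace K
  haveI : CompactSpace (decomp (K := K) v) :=
    isCompact_iff_compactSpace.mp (isClosed_decomp v).isCompact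
  obtain ⟨U, hU⟩ := exists_openNormalSubgroup_conjH1_kerD_eq κ hstab v f
  haveI : Finite (decomp (K := K) v ⧸ U.toSubgroup) := Subgroup.quotient_finite_of_isOpen _ U.isOpen
  have hm : U.toSubgroup.index ≠ 0 := Subgroup.index_ne_zero_of_finite
  obtain ⟨a, e, he, hme⟩ := Nat.exists_eq_pow_mul_and_not_dvd hm p (Fact.out : p.Prime).ne_one
  obtain ⟨u, hu⟩ := IwasawaDual.isUnit_natCast_padicInt (p := p) he
  refine ⟨c + a, fun d hd ↦ ?_⟩
  obtain ⟨z, hz⟩ := hd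
  obtain ⟨d₃, hd₃⟩ := hc (z * ((u⁻¹ : ℤ_[p]ˣ) : ℤ_[p]))
  -- `κ (d₃ ^ m) = κ d`
  have hκ : (κ ((d₃ : absoluteGaloisGroup K) ^ U.toSubgroup.index)).toAdd =
      (κ (d : absoluteGaloisGroup K)).toAdd := by
    rw [map_pow, ← ofAdd_toAdd (κ (d₃ : absoluteGaloisGroup K)), ← ofAdd_nsmul, toAdd_ofAdd, hd₃, hz,
      nsmul_eq_mul, hme, Nat.cast_mul, Nat.cast_pow, ← hu, pow_add]
    rw [show ((p : ℤ_[p]) ^ a * (u : ℤ_[p])) * ((p : ℤ_[p]) ^ c * (z * ((u⁻¹ : ℤ_[p]ˣ) : ℤ_[p]))) =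
      (p : ℤ_[p]) ^ c * (p : ℤ_[p]) ^ a * z * ((u : ℤ_[p]) * ((u⁻¹ : ℤ_[p]ˣ) : ℤ_[p])) by ring,
      Units.mul_inv, mul_one]
  have hk : ((d₃ ^ U.toSubgroup.index)⁻¹ * d : decomp (K := K) v) ∈ kerD κ v := by
    rw [mem_kerD_iff, ZpExtension.mem_kerSubgroup, Subgroup.coe_mul, Subgroup.coe_inv,
      Subgroup.coe_pow, map_mul, map_inv]
    apply Multiplicative.toAdd.injective
    rw [toAdd_mul, toAdd_inv, hκ, toAdd_one, neg_add_cancel]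
  have hdU : d₃ ^ U.toSubgroup.index ∈ U := U.toSubgroup.pow_index_mem d₃
  conv_lhs => rw [← mul_inv_cancel_left (d₃ ^ U.toSubgroup.index) d]
  rw [conjH1_mul_holds (kerD κ v) M, AddMonoidHom.comp_apply,
    conjH1_of_mem_holds (kerD κ v) M hk, AddMonoidHom.id_apply]
  exact hU _ hdU

/-- **(P)_v.** Every class of `H¹(H ∩ D_v, M)` is killed by a power of `p` when `M` is `p`-primary
(`H ∩ D_v` is compact, the cocycle has finitely many values). [cite: GreenbergLNM1716, §1 (after Conj. 1.3)] -/
theorem exists_pow_smul_kerD_eq_zero (htor : ∀ m : M, ∃ k : ℕ, p ^ k • m = 0)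
    (v : HeightOneSpectrum (𝓞 K)) (f : subgroupH1 (kerD κ v) M) : ∃ k : ℕ, p ^ k • f = 0 := by
  haveI : CompactSpace (absoluteGaloisGroup K) := absoluteGaloisGroup_compactSpace K
  haveI : CompactSpace (decomp (K := K) v) :=
    isCompact_iff_compactSpace.mp (isClosed_decomp v).isCompact
  haveI : CompactSpace (kerD κ v) := isCompact_iff_compactSpace.mp (isClosed_kerD κ v).isCompact
  obtain ⟨φ, rfl⟩ := oneCocycleClass_surjective _ f
  exact IwasawaDual.exists_pow_smul_oneCocycleClass_eq_zero φ fun g ↦ htor (φ.1 g)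

/-- **(A2)_v + (P)_v, uniformly on finitely many classes**: one `t` and one `k` for a finite family.
[cite: GreenbergLNM1716, §1 (after Conj. 1.3)] -/
theorem exists_forall_dvd_imp_conjH1_kerD_eq_finset
    (hstab : ∀ m : M,
      IsOpen (MulAction.stabilizer (absoluteGaloisGroup K) m : Set (absoluteGaloisGroup K)))
    (htor : ∀ m : M, ∃ k : ℕ, p ^ k • m = 0)
    (v : HeightOneSpectrum (𝓞 K)) {c : ℕ}
    (hc : ∀ z : ℤ_[p], ∃ d : decomp (K := K) v,
      (κ (d : absoluteGaloisGroup K)).toAdd = (p : ℤ_[p]) ^ c * z)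
    (s : Finset (subgroupH1 (kerD κ v) M)) :
    ∃ t k : ℕ, ∀ f ∈ s, (p ^ k • f = 0) ∧ ∀ d : decomp (K := K) v,
      (p : ℤ_[p]) ^ t ∣ (κ (d : absoluteGaloisGroup K)).toAdd → conjH1 (kerD κ v) M d f = f := by
  classical
  induction s using Finset.induction_on with
  | empty => exact ⟨0, 0, fun f hf ↦ (Finset.notMem_empty f hf).elim⟩
  | insert a s ha ih =>
    obtain ⟨t, k, hts⟩ := ih
    obtain ⟨t', ht'⟩ := exists_forall_dvd_imp_conjH1_kerD_eq κ hstab v hc a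
    obtain ⟨k', hk'⟩ := exists_pow_smul_kerD_eq_zero κ htor v a
    refine ⟨t + t', k + k', fun f hf ↦ ?_⟩
    rcases Finset.mem_insert.mp hf with rfl | hf
    · refine ⟨by rw [pow_add, mul_smul, hk', smul_zero], fun d hd ↦ ht' d ?_⟩
      exact (pow_dvd_pow _ (Nat.le_add_left t' t)).trans hd
    · refine ⟨by rw [pow_add, mul_comm, mul_smul, (hts f hf).1, smul_zero],
        fun d hd ↦ (hts f hf).2 d ?_⟩
      exact (pow_dvd_pow _ (Nat.le_add_right t t')).trans hd

end Stabilizer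

end Summit.BirchSwinnertonDyer.BirchSwinnertonDyer.Theorems.UniversalToricDescentSigmaLocalStabilizer

end
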